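import Literature.NumberTheory.Automorphic.QuadraticBaseChangeFrobCompatibleSplitAuxFieldProofs
import Literature.NumberTheory.Automorphic.HilbertModularGaloisRepUnramified
import HarnessLib

/-!
# `Langlands1980_quadraticBaseChange_frobCompatible` from four named facts of the tree (assembly)

Topic `Literature/NumberTheory/Automorphic`; proof companion (theorems only, no `sorry`, no new
named fact) of the seat of `Langlands1980_quadraticBaseChange_frobCompatible`
(`QuadraticBaseChangeFrobCompatible`).  The reduction
`Langlands1980_quadraticBaseChange_frobCompatible_of_carayol'` of
`QuadraticBaseChangeFrobCompatibleSplitAuxFieldProofs` takes Carayol's theorem as an INLINE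
hypothesis `hCar` (form (C')); here that hypothesis is fed by the named fact
`Carayol1986_unramifiedCompatibility` (`HilbertModularGaloisRepUnramified`: Carayol 1986 Thm. (A)
with §0.5; Taylor 1989/1990 in even degree; Skinner 2009 §1 (1)), whose statement is `hCar`
verbatim, so that the named fact of the tree is now a consequence of FOUR NAMED FACTS:

* `Carayol1986_unramifiedCompatibility` (Carayol 1986, Thm. (A));
* `ArthurClozel1989_strongLifting_archimedean` (Arthur–Clozel 1989, Ch. 3 Thm. 5.1 with Ch. 1 §7);
* `baseChange_cyclic_cuspidal` (Arthur–Clozel 1989, Ch. 3 Thm. 4.2 (a));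
* `ArthurClozel1989_strongLifting_unramified` (Arthur–Clozel 1989, Ch. 3 Thm. 5.1 with Ch. 1 §6).

The discharge `Langlands1980_quadraticBaseChange_frobCompatible_holds` is then the one-liner
`Langlands1980_quadraticBaseChange_frobCompatible_of_facts Carayol1986_unramifiedCompatibility_holds
ArthurClozel1989_strongLifting_archimedean_holds baseChange_cyclic_cuspidal_holds
ArthurClozel1989_strongLifting_unramified_holds` once those four theorems exist (none does today:
Shimura-curve cohomology, resp. the twisted trace formula).

## References

* R. P. Langlands, *Base change for GL(2)*, Ann. of Math. Stud. 96 (1980), §2 (A), (F) (pp. 19–20)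
  with (i) (p. 13). [LanglandsBaseChange1980]
* H. Carayol, Ann. Sci. ÉNS 19 (1986), Thm. (A) (pp. 410–411), §0.5. [CarayolASENS1986]
* J. Arthur, L. Clozel, Ann. of Math. Stud. 120 (1989), Ch. 3 Thm. 4.2 (a), Thm. 5.1.
  [ArthurClozelAMS120]
-/

noncomputable section

open scoped MatrixGroups Matrix NumberField Polynomial Classical
open NumberField IsDedekindDomain Field Polynomial Filter

namespace Literature.NumberTheory.Automorphic

open Literature.NumberTheory.GaloisRepresentations

/-- **`Langlands1980_quadraticBaseChange_frobCompatible` from four named facts**: Carayol's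
local–global compatibility in the unramified a.e. form (`Carayol1986_unramifiedCompatibility`) and
three clauses of Langlands' quadratic base change as vendored from Arthur–Clozel
(`ArthurClozel1989_strongLifting_archimedean`, `baseChange_cyclic_cuspidal`,
`ArthurClozel1989_strongLifting_unramified`).  Immediate from
`Langlands1980_quadraticBaseChange_frobCompatible_of_carayol'`, whose inline hypothesis `hCar` is the
statement of the Carayol fact verbatim (definitional unfolding).
[cite: LanglandsBaseChange1980, §2 (A), (F) (pp. 19–20) with (i) (p. 13)]
[cite: CarayolASENS1986, Thm. (A) (pp. 410–411) with §0.5]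
[cite: ArthurClozelAMS120, Ch. 3 Thm. 4.2 (a), Thm. 5.1] -/
theorem Langlands1980_quadraticBaseChange_frobCompatible_of_facts
    (hCar : Carayol1986_unramifiedCompatibility)
    (hArch : ArthurClozel1989_strongLifting_archimedean)
    (hBCc : baseChange_cyclic_cuspidal) (hACu : ArthurClozel1989_strongLifting_unramified) :
    Langlands1980_quadraticBaseChange_frobCompatible :=
  Langlands1980_quadraticBaseChange_frobCompatible_of_carayol' hCar hArch hBCc hACu

-- When the four discharges exist (check `lean search '…_holds' --decl`), append:
-- theorem Langlands1980_quadraticBaseChange_frobCompatible_holds :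
--     Langlands1980_quadraticBaseChange_frobCompatible :=
--   Langlands1980_quadraticBaseChange_frobCompatible_of_facts Carayol1986_unramifiedCompatibility_holds
--     ArthurClozel1989_strongLifting_archimedean_holds baseChange_cyclic_cuspidal_holds
--     ArthurClozel1989_strongLifting_unramified_holds

end Literature.NumberTheory.Automorphic

end
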